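import Mathlib
import Summits.Ventures.PercRepro2.PackPattern
import Summits.Ventures.PercRepro2.AbsPattern

/-!
# Probability-level rows for the packing number of every event, through the pattern bridge
(seat mine-b, cell pub-perc-repro2; conjectures/MINE-B.md §12 Addendum 7)

The abstract pattern theorems `absT_zero_add_le` (Reimer for every split) and `absH_zero_two_le`
(the STEP row `(0,2)`) transported by the bridge of PackPattern.lean: for every event `A` on subsets
and every product measure, `P(pack ≥ a+b) ≤ P(pack ≥ a)·P(pack ≥ b)` (`packTail_add_le`) and
`P(pack = 0)·P(pack ≥ 2) ≤ P(pack = 1)·P(pack ≥ 1)` (`packStep_zero_two`).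
-/

open Finset

namespace Summit.Ventures.PercRepro2

namespace StepZero

open ReimerCube

variable {E : Type*} [Fintype E] [DecidableEq E]

omit [DecidableEq E] in
/-- `pack ≥ 0` is the sure event -/
lemma packEvent_zero (A : Finset E → Prop) : packEvent A 0 = Set.univ := by
  ext ω; simp [packEvent, kDisj]

/-- **`P(pack ≥ a+b) ≤ P(pack ≥ a)·P(pack ≥ b)`** for every event and every product measure
(the general-split BK inequality for packing numbers, from the pattern-level
`absT_zero_add_le` through the bridge). -/
theorem packTail_add_le {p : E → ℝ} (hp : IsProbVec p) (A : Finset E → Prop) (a b : ℕ) :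
    prob p (packEvent A (a + b)) ≤ prob p (packEvent A a) * prob p (packEvent A b) := by
  have hc : ∀ mj : Config E × Config E, (0 : ℝ) ≤ patternCoeff (packEvent A a) (packEvent A b)
      (packEvent A 0) (packEvent A (a + b)) mj := by
    rintro ⟨m, j⟩
    by_cases hmj : m ≤ j
    · rw [patternCoeff_packEvent A a b 0 (a + b) m j hmj]
      have := absT_zero_add_le A (openSet m) (openSet j \ openSet m) a b
      have h' : ((absT A (openSet m) (openSet j \ openSet m) 0 (a + b) : ℕ) : ℝ)
          ≤ ((absT A (openSet m) (openSet j \ openSet m) a b : ℕ) : ℝ) := by exact_mod_cast this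
      linarith
    · rw [patternCoeff_eq_zero_of_not_le _ _ _ _ m j hmj]
  have hs := slack_nonneg_of_patternCoeff_nonneg hp (packEvent A a) (packEvent A b)
    (packEvent A 0) (packEvent A (a + b)) hc
  unfold slack at hs
  rw [packEvent_zero] at hs
  have hu : prob p (Set.univ : Set (Config E)) = 1 := prob_univ p
  rw [hu] at hs
  linarith

/-- **`P(pack = 0)·P(pack ≥ 2) ≤ P(pack = 1)·P(pack ≥ 1)`** for every increasing event and every
product measure (the Reimer row of the STEP family at the probability level, from
`absH_zero_two_le` through the bridge). -/
theorem packStep_zero_two {p : E → ℝ} (hp : IsProbVec p) {A : Finset E → Prop} (hA : Incr A) :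
    prob p (packExact A 0) * prob p (packEvent A 2)
      ≤ prob p (packExact A 1) * prob p (packEvent A 1) := by
  have h := packStep_of_absH hp A 0 2 (fun O Y _ => absH_zero_two_le hA O Y)
  simpa using h

end StepZero

end Summit.Ventures.PercRepro2
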